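import Literature.Probability.Percolation.MagnetizationLowerBound
import Literature.Probability.FitznerVanDerHofstad2017.MeanFieldExponents
import HarnessLib

/-!
# `δ = 2` (lower half) and mean-field behaviour from the triangle condition:
# `TriangleCondition d → MeanField d`

Topic `Literature/Probability/FitznerVanDerHofstad2017`, family `crit-perc` (cell `b2b-lace`,
literature seat). Completes the exponent part of

* R. Fitzner, R. van der Hofstad, *Mean-field behavior for nearest-neighbor percolation in `d > 10`*,
  Electron. J. Probab. **22** (2017) no. 43, Cor. 1.3 (EJP p. 6): "the triangle condition holds.
  Therefore the critical exponents `γ, β` and `δ` exist in the bounded-ratio sense, and take on the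
  mean-field values `γ = β = 1, δ = 2`",

as a theorem `meanField_of_triangle : 2 ≤ d → TriangleCondition d → MeanField d` of this library
(`MeanField d := θ(p_c) = 0 ∧ γ = 1 ∧ β = 1 ∧ δ = 2`, `MeanFieldExponents.lean`, where the first three
conjuncts and the upper half of the fourth were already derived, `exponents_of_triangle`, and "the
lower half of `δ = 2` (`P_{p_c}(|𝒞| ≥ n) ≥ c/√n`) is not formalised at this library version").

The missing lower half is PROVED here following M. Heydenreich, R. van der Hofstad, *Progress in
High-Dimensional Percolation and Random Graphs* (Springer 2017), Thm. 9.2, proof of the lower bound,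
(9.2.7)–(9.2.11): from the two generating-function bounds
`c√γ ≤ M(p_c,γ)` (Aizenman–Barsky 1987 / Prop. 3.6 — the tree's
`magnetization_criticalProb_ge_sqrt`, every `d ≥ 2`) and `M(p_c,γ̃) ≤ C√γ̃` (from the volume-tail
upper bound `P_{p_c}(|C| ≥ n) ≤ C/√n`, the tree's `real_clusterSizeGe_criticalProb_le_of_gamma` under
the triangle condition, by Abel summation — `geometric_series_le_of_tail_le`), the split
`M(γ) ≤ γ Σ_{s<n} P(|C| ≥ s+1) + P(|C| ≥ n)` with `Σ_{s<n} P(|C| ≥ s+1) ≤ 12 C √n`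
(`γ̃ = 1/(2n)`) and the choice `γ = c²/(576 C² n)` give `P_{p_c}(|C| ≥ n) ≥ (c²/(48C))/√n`
(`tail_ge_of_geometric_series_ge`; the printed choice is `γ̃ = 1/n`, `γ = 1/(3600 n)` with the
printed constants `1/3`, `√12`). Stated for an abstract non-increasing `[0,1]`-valued sequence, then
instantiated: `real_clusterSizeGe_criticalProb_ge_of_triangle`, `deltaEqTwoBoundedRatio_of_triangle`,
`meanField_of_triangle`. No definitions, no named facts; axioms standard.

## References

* M. Heydenreich, R. van der Hofstad, Springer 2017: Thm. 9.2 and (9.2.6)–(9.2.11); Thm. 4.1.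
  [HeydenreichVanDerHofstad2017]
* R. Fitzner, R. van der Hofstad, EJP 22 (2017) no. 43: Cor. 1.3, (1.8). [FitznerVanDerHofstad2017]
* D. J. Barsky, M. Aizenman, Ann. Probab. 19 (1991) 1520–1536 (δ = 2 under the triangle condition).
  [BarskyAizenman1991]
* M. Aizenman, D. J. Barsky, Comm. Math. Phys. 108 (1987): Thm. 1.2. [AizenmanBarsky1987]
-/

noncomputable section

namespace Literature.Probability.Percolation

open MeasureTheory Filter Topology
open Literature.Probability.LatticeModels
open scoped ENNReal

/-! ### From the two generating-function bounds to the volume tail (HvdH Thm. 9.2, lower half) -/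

section TailFromGF

/-- The weighted series `γ Σ_s (1-γ)^s P(s+1)` of a `[0,1]`-valued sequence is summable termwise
dominated by the geometric series. [folklore] -/
theorem summable_geometric_mul_of_le_one {P : ℕ → ℝ} (hP0 : ∀ n, 0 ≤ P n) (hP1 : ∀ n, P n ≤ 1)
    {γ : ℝ} (h0 : 0 < γ) (h1 : γ < 1) : Summable fun s : ℕ => (1 - γ) ^ s * P (s + 1) :=
  Summable.of_nonneg_of_le (fun s => mul_nonneg (pow_nonneg (by linarith) _) (hP0 _))
    (fun s => mul_le_of_le_one_right (pow_nonneg (by linarith) _) (hP1 _))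
    (summable_geometric_of_lt_one (by linarith) (by linarith))

/-- **A volume-tail upper bound gives a generating-function upper bound**: if `P` is non-increasing,
`[0,1]`-valued and `P(n) ≤ C/√n` for `n ≥ 1`, then `γ Σ_s (1-γ)^s P(s+1) ≤ 4C √γ` for `0 < γ < 1`
(the easy direction of HvdH (9.2.6); summation by parts with the split at `s ≈ 1/γ`).
[cite: HeydenreichVanDerHofstad2017, §9.2 (9.2.6)–(9.2.9)] -/
theorem geometric_series_le_of_tail_le {P : ℕ → ℝ} (hP0 : ∀ n, 0 ≤ P n) (hP1 : ∀ n, P n ≤ 1)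
    (hanti : Antitone P) {C : ℝ} (hC : ∀ n : ℕ, 1 ≤ n → P n ≤ C / Real.sqrt n)
    {γ : ℝ} (h0 : 0 < γ) (h1 : γ < 1) :
    γ * ∑' s : ℕ, (1 - γ) ^ s * P (s + 1) ≤ 4 * C * Real.sqrt γ := by
  have hC0 : 0 ≤ C := by
    have := hC 1 le_rfl
    rw [Nat.cast_one, Real.sqrt_one, div_one] at this
    exact (hP0 1).trans this
  -- `Σ_{s<N} 1/√(s+1) ≤ 2√N` (telescoping `1/√(s+1) ≤ 2(√(s+1) - √s)`; cf. the tree's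
  -- `RobertSargos.Thm1.sum_inv_sqrt_le`, not imported here)
  have sum_range_inv_sqrt_le : ∀ N : ℕ,
      ∑ s ∈ Finset.range N, 1 / Real.sqrt ((s : ℝ) + 1) ≤ 2 * Real.sqrt N := by
    intro N
    have hterm : ∀ s : ℕ, 1 / Real.sqrt ((s : ℝ) + 1) ≤
        2 * (Real.sqrt ((s + 1 : ℕ) : ℝ) - Real.sqrt (s : ℝ)) := by
      intro s
      have hs0 : (0 : ℝ) ≤ s := Nat.cast_nonneg s
      have h1 : 0 < Real.sqrt ((s : ℝ) + 1) := Real.sqrt_pos.2 (by linarith)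
      have hcast : ((s + 1 : ℕ) : ℝ) = (s : ℝ) + 1 := by push_cast; ring
      rw [hcast]
      have hle : Real.sqrt (s : ℝ) ≤ Real.sqrt ((s : ℝ) + 1) := Real.sqrt_le_sqrt (by linarith)
      -- `(√(s+1) - √s)(√(s+1) + √s) = 1` and `√(s+1) + √s ≤ 2√(s+1)`
      have hprod : (Real.sqrt ((s : ℝ) + 1) - Real.sqrt (s : ℝ)) * (Real.sqrt ((s : ℝ) + 1) + Real.sqrt (s : ℝ)) = 1 := by
        have e1 : Real.sqrt ((s : ℝ) + 1) * Real.sqrt ((s : ℝ) + 1) = (s : ℝ) + 1 := Real.mul_self_sqrt (by linarith)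
        have e2 : Real.sqrt (s : ℝ) * Real.sqrt (s : ℝ) = (s : ℝ) := Real.mul_self_sqrt hs0
        nlinarith [e1, e2]
      rw [div_le_iff₀ h1]
      nlinarith [hprod, hle, Real.sqrt_nonneg (s : ℝ)]
    calc ∑ s ∈ Finset.range N, 1 / Real.sqrt ((s : ℝ) + 1)
        ≤ ∑ s ∈ Finset.range N, 2 * (Real.sqrt ((s + 1 : ℕ) : ℝ) - Real.sqrt (s : ℝ)) :=
          Finset.sum_le_sum fun s _ => hterm s
      _ = 2 * (Real.sqrt (N : ℝ) - Real.sqrt ((0 : ℕ) : ℝ)) := by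
          rw [← Finset.mul_sum, Finset.sum_range_sub (fun i => Real.sqrt (i : ℝ)) N]
      _ = 2 * Real.sqrt N := by simp
  have ht0 : 0 ≤ 1 - γ := by linarith
  have ht1 : 1 - γ < 1 := by linarith
  have hsum := summable_geometric_mul_of_le_one hP0 hP1 h0 h1
  -- split at `N = ⌊1/γ⌋₊ + 1`
  set N : ℕ := ⌊1 / γ⌋₊ + 1 with hN
  have hN1 : 1 ≤ N := by omega
  have hNpos : (0 : ℝ) < N := by exact_mod_cast hN1
  have hNge : 1 / γ ≤ (N : ℝ) := by
    rw [hN]; push_cast; exact (Nat.lt_floor_add_one (1 / γ)).le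
  have hNle : (N : ℝ) ≤ 2 / γ := by
    rw [hN]; push_cast
    have hf : (⌊1 / γ⌋₊ : ℝ) ≤ 1 / γ := Nat.floor_le (by positivity)
    have h1γ : 1 ≤ 1 / γ := by rw [le_div_iff₀ h0]; linarith
    have h2γ : (2 : ℝ) / γ = 2 * (1 / γ) := by ring
    linarith
  rw [← Summable.sum_add_tsum_nat_add N hsum]
  -- head: `Σ_{s<N} (1-γ)^s P(s+1) ≤ Σ_{s<N} C/√(s+1) ≤ 2C√N`
  have hhead : ∑ s ∈ Finset.range N, (1 - γ) ^ s * P (s + 1) ≤ 2 * C * Real.sqrt N := by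
    calc ∑ s ∈ Finset.range N, (1 - γ) ^ s * P (s + 1)
        ≤ ∑ s ∈ Finset.range N, C * (1 / Real.sqrt ((s : ℝ) + 1)) := Finset.sum_le_sum fun s _ => by
          have hp := hC (s + 1) (by omega)
          have hcast : ((s + 1 : ℕ) : ℝ) = (s : ℝ) + 1 := by push_cast; ring
          rw [hcast] at hp
          calc (1 - γ) ^ s * P (s + 1) ≤ 1 * P (s + 1) :=
                mul_le_mul_of_nonneg_right (pow_le_one₀ ht0 ht1.le) (hP0 _)
            _ ≤ C * (1 / Real.sqrt ((s : ℝ) + 1)) := by rw [one_mul, mul_one_div]; exact hp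
      _ = C * ∑ s ∈ Finset.range N, 1 / Real.sqrt ((s : ℝ) + 1) := by rw [Finset.mul_sum]
      _ ≤ C * (2 * Real.sqrt N) := mul_le_mul_of_nonneg_left (sum_range_inv_sqrt_le N) hC0
      _ = 2 * C * Real.sqrt N := by ring
  -- tail: `Σ_s (1-γ)^{s+N} P(s+N+1) ≤ P(N) (1-γ)^N / γ ≤ (C/√N) / γ`
  have htail : ∑' s : ℕ, (1 - γ) ^ (s + N) * P (s + N + 1) ≤ C / Real.sqrt N / γ := by
    have hgeo : HasSum (fun s : ℕ => (1 - γ) ^ N * P N * (1 - γ) ^ s) ((1 - γ) ^ N * P N * γ⁻¹) := by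
      have h := hasSum_geometric_of_lt_one ht0 ht1
      rw [show (1 : ℝ) - (1 - γ) = γ by ring] at h
      exact h.mul_left _
    calc ∑' s : ℕ, (1 - γ) ^ (s + N) * P (s + N + 1)
        ≤ ∑' s : ℕ, (1 - γ) ^ N * P N * (1 - γ) ^ s := by
          refine Summable.tsum_le_tsum (fun s => ?_) ?_ hgeo.summable
          · rw [pow_add]
            have := hanti (show N ≤ s + N + 1 by omega)
            calc (1 - γ) ^ s * (1 - γ) ^ N * P (s + N + 1) ≤ (1 - γ) ^ s * (1 - γ) ^ N * P N :=
                  mul_le_mul_of_nonneg_left this (mul_nonneg (pow_nonneg ht0 s) (pow_nonneg ht0 N))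
              _ = (1 - γ) ^ N * P N * (1 - γ) ^ s := by ring
          · exact (summable_nat_add_iff N).2 hsum |>.congr (fun s => by ring_nf)
      _ = (1 - γ) ^ N * P N * γ⁻¹ := hgeo.tsum_eq
      _ ≤ 1 * (C / Real.sqrt N) * γ⁻¹ :=
          mul_le_mul_of_nonneg_right (mul_le_mul (pow_le_one₀ ht0 ht1.le) (hC N hN1) (hP0 N) zero_le_one)
            (inv_nonneg.2 h0.le)
      _ = C / Real.sqrt N / γ := by ring
  -- combine: `γ (2C√N + C/(√N γ)) ≤ 2C γ √(2/γ) + C/√N ≤ 4C√γ`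
  have hsγ : 0 < Real.sqrt γ := Real.sqrt_pos.2 h0
  have hsN : 0 < Real.sqrt N := Real.sqrt_pos.2 hNpos
  have hb1 : γ * (2 * C * Real.sqrt N) ≤ 2 * Real.sqrt 2 * C * Real.sqrt γ := by
    -- `γ √N ≤ γ √(2/γ) = √2 √γ`
    have h2 : Real.sqrt (N : ℝ) ≤ Real.sqrt (2 / γ) := Real.sqrt_le_sqrt hNle
    have h3 : Real.sqrt (2 / γ) = Real.sqrt 2 / Real.sqrt γ := Real.sqrt_div' 2 h0.le
    have h4 : γ / Real.sqrt γ = Real.sqrt γ := by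
      rw [div_eq_iff hsγ.ne', Real.mul_self_sqrt h0.le]
    calc γ * (2 * C * Real.sqrt N) ≤ γ * (2 * C * Real.sqrt (2 / γ)) := by gcongr
      _ = 2 * Real.sqrt 2 * C * (γ / Real.sqrt γ) := by rw [h3]; ring
      _ = 2 * Real.sqrt 2 * C * Real.sqrt γ := by rw [h4]
  have hb2 : γ * (C / Real.sqrt N / γ) ≤ C * Real.sqrt γ := by
    rw [mul_div_cancel₀ _ h0.ne']
    -- `1/√N ≤ √γ` since `N ≥ 1/γ`
    rw [div_le_iff₀ hsN]
    have h5 : 1 ≤ Real.sqrt γ * Real.sqrt N := by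
      rw [← Real.sqrt_mul h0.le]
      rw [show (1 : ℝ) = Real.sqrt 1 from Real.sqrt_one.symm]
      refine Real.sqrt_le_sqrt ?_
      calc (1 : ℝ) = γ * (1 / γ) := by field_simp
        _ ≤ γ * N := mul_le_mul_of_nonneg_left hNge h0.le
    nlinarith [h5, hC0]
  have hsqrt2 : Real.sqrt 2 ≤ 3 / 2 := by
    rw [show (3 / 2 : ℝ) = Real.sqrt ((3 / 2) ^ 2) by rw [Real.sqrt_sq (by norm_num)]]
    exact Real.sqrt_le_sqrt (by norm_num)
  calc γ * (∑ s ∈ Finset.range N, (1 - γ) ^ s * P (s + 1) + ∑' s : ℕ, (1 - γ) ^ (s + N) * P (s + N + 1))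
      ≤ γ * (2 * C * Real.sqrt N) + γ * (C / Real.sqrt N / γ) := by
        rw [← mul_add]; exact mul_le_mul_of_nonneg_left (add_le_add hhead htail) h0.le
    _ ≤ 2 * Real.sqrt 2 * C * Real.sqrt γ + C * Real.sqrt γ := add_le_add hb1 hb2
    _ ≤ 4 * C * Real.sqrt γ := by
        have k := mul_nonneg (mul_nonneg hC0 hsγ.le) (show (0 : ℝ) ≤ 3 - 2 * Real.sqrt 2 by linarith)
        have e : C * Real.sqrt γ * (3 - 2 * Real.sqrt 2) =
            3 * (C * Real.sqrt γ) - 2 * Real.sqrt 2 * C * Real.sqrt γ := by ring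
        linarith

/-- **From the generating-function bounds `c√γ ≤ M(γ)` and `P(n) ≤ C/√n` to the volume tail**
(HvdH 2017, proof of the lower bound in Thm. 9.2, (9.2.7)–(9.2.11), in the Abel-summed form
`M(γ) ≤ γ Σ_{s<n} P(s+1) + P(n)` and `Σ_{s<n} P(s+1) ≤ 4n M(1/(2n))`): `P(n) ≥ (c²/(48C))/√n` for
all `n ≥ 1`. [cite: HeydenreichVanDerHofstad2017, §9.2, proof of the lower bound in Thm. 9.2, (9.2.7)–(9.2.11)] -/
theorem tail_ge_of_geometric_series_ge {P : ℕ → ℝ} (hP0 : ∀ n, 0 ≤ P n) (hP1 : ∀ n, P n ≤ 1)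
    (hanti : Antitone P) {c C : ℝ} (hc : 0 < c)
    (hM : ∀ γ : ℝ, 0 < γ → γ < 1 → c * Real.sqrt γ ≤ γ * ∑' s : ℕ, (1 - γ) ^ s * P (s + 1))
    (hC : ∀ n : ℕ, 1 ≤ n → P n ≤ C / Real.sqrt n) :
    ∀ n : ℕ, 1 ≤ n → c ^ 2 / (48 * C) / Real.sqrt n ≤ P n := by
  -- `c ≤ 4C` (compare the two bounds at `γ = 1/2`), so `C > 0`
  have hcC : c ≤ 4 * C := by
    have h1 := hM (1 / 2) (by norm_num) (by norm_num)
    have h2 := geometric_series_le_of_tail_le hP0 hP1 hanti hC (γ := 1 / 2) (by norm_num) (by norm_num)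
    have hs : 0 < Real.sqrt (1 / 2 : ℝ) := Real.sqrt_pos.2 (by norm_num)
    nlinarith [h1.trans h2]
  have hC0 : 0 < C := by linarith
  intro n hn
  have hn0 : (0 : ℝ) < n := by exact_mod_cast hn
  have hsn : 0 < Real.sqrt n := Real.sqrt_pos.2 hn0
  -- Step 1: `S_n := Σ_{s<n} P(s+1) ≤ 3 C √n`, from `M(1/(2n)) ≤ 4C √(1/(2n))`
  set Sn : ℝ := ∑ s ∈ Finset.range n, P (s + 1) with hSn
  have hSn0 : 0 ≤ Sn := Finset.sum_nonneg fun s _ => hP0 _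
  have hS : Sn ≤ 12 * C * Real.sqrt n := by
    set γ' : ℝ := 1 / (2 * n) with hγ'
    have hγ'0 : 0 < γ' := by positivity
    have hγ'1 : γ' < 1 := by
      rw [hγ', div_lt_one (by positivity)]; linarith [show (1 : ℝ) ≤ n by exact_mod_cast hn]
    have hup := geometric_series_le_of_tail_le hP0 hP1 hanti hC hγ'0 hγ'1
    -- `γ' (1-γ')^{n} S_n ≤ γ' Σ_{s<n} (1-γ')^s P(s+1) ≤ M(γ')`
    have hsum := summable_geometric_mul_of_le_one hP0 hP1 hγ'0 hγ'1
    have hlow : γ' * ((1 - γ') ^ n * Sn) ≤ γ' * ∑' s : ℕ, (1 - γ') ^ s * P (s + 1) := by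
      refine mul_le_mul_of_nonneg_left ?_ hγ'0.le
      calc (1 - γ') ^ n * Sn = ∑ s ∈ Finset.range n, (1 - γ') ^ n * P (s + 1) := by rw [hSn, Finset.mul_sum]
        _ ≤ ∑ s ∈ Finset.range n, (1 - γ') ^ s * P (s + 1) := Finset.sum_le_sum fun s hs => by
            exact mul_le_mul_of_nonneg_right
              (pow_le_pow_of_le_one (by linarith) (by linarith) (Finset.mem_range.1 hs).le) (hP0 _)
        _ ≤ ∑' s : ℕ, (1 - γ') ^ s * P (s + 1) :=
            hsum.sum_le_tsum (Finset.range n) fun s _ => mul_nonneg (pow_nonneg (by linarith) _) (hP0 _)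
    -- Bernoulli: `(1 - 1/(2n))^n ≥ 1/2`
    have hbern : (1 / 2 : ℝ) ≤ (1 - γ') ^ n := by
      have hb := one_add_mul_le_pow (show (-2 : ℝ) ≤ -γ' by rw [hγ']; linarith [hγ'1]) n
      have : (n : ℝ) * -γ' = -(1 / 2) := by rw [hγ']; field_simp
      rw [this, show (1 : ℝ) + -γ' = 1 - γ' by ring] at hb
      linarith
    -- `√(1/(2n)) ≤ 1/√n`... we use `4C√γ' · (2/γ') = 8C/√γ'... ` directly:
    have hsγ' : Real.sqrt γ' * Real.sqrt γ' = γ' := Real.mul_self_sqrt hγ'0.le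
    have hsq : Real.sqrt γ' ≤ Real.sqrt n * γ' * Real.sqrt 2 := by
      -- `√γ' = 1/√(2n)` and `√n γ' √2 = √2 √n/(2n) = 1/√(2n)`
      have e1 : Real.sqrt γ' = 1 / (Real.sqrt 2 * Real.sqrt n) := by
        rw [hγ', Real.sqrt_div' 1 (by positivity), Real.sqrt_one, Real.sqrt_mul (by norm_num)]
      have e2 : Real.sqrt 2 * Real.sqrt 2 = 2 := Real.mul_self_sqrt (by norm_num)
      have e3 : Real.sqrt (n : ℝ) * Real.sqrt n = n := Real.mul_self_sqrt hn0.le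
      have hs2 : 0 < Real.sqrt 2 := Real.sqrt_pos.2 (by norm_num)
      rw [e1, hγ', div_le_iff₀ (by positivity)]
      have : Real.sqrt ↑n * (1 / (2 * ↑n)) * Real.sqrt 2 * (Real.sqrt 2 * Real.sqrt ↑n) =
          (Real.sqrt 2 * Real.sqrt 2) * (Real.sqrt ↑n * Real.sqrt ↑n) / (2 * n) := by ring
      rw [this, e2, e3]
      field_simp
      exact le_refl _
    have hchain : γ' * ((1 - γ') ^ n * Sn) ≤ 4 * C * (Real.sqrt n * γ' * Real.sqrt 2) :=
      (hlow.trans hup).trans (mul_le_mul_of_nonneg_left hsq (by positivity))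
    have hsqrt2 : Real.sqrt 2 ≤ 3 / 2 := by
      rw [show (3 / 2 : ℝ) = Real.sqrt ((3 / 2) ^ 2) by rw [Real.sqrt_sq (by norm_num)]]
      exact Real.sqrt_le_sqrt (by norm_num)
    -- divide by `γ' > 0` and use `(1-γ')^n ≥ 1/2`
    have h6 : (1 - γ') ^ n * Sn ≤ 4 * C * Real.sqrt n * Real.sqrt 2 := by
      have := hchain
      rw [show 4 * C * (Real.sqrt ↑n * γ' * Real.sqrt 2) = γ' * (4 * C * Real.sqrt n * Real.sqrt 2) by ring] at this
      exact le_of_mul_le_mul_left this hγ'0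
    have h7 : Sn ≤ 2 * ((1 - γ') ^ n * Sn) := by nlinarith [hbern, hSn0]
    have h8 : 4 * C * Real.sqrt n * Real.sqrt 2 ≤ 4 * C * Real.sqrt n * (3 / 2) :=
      mul_le_mul_of_nonneg_left hsqrt2 (by positivity)
    linarith
  -- Step 2: `M(γ) ≤ γ S_n + P(n)` for every `γ ∈ (0,1)`
  have hsplit : ∀ γ : ℝ, 0 < γ → γ < 1 →
      γ * ∑' s : ℕ, (1 - γ) ^ s * P (s + 1) ≤ γ * Sn + P n := by
    intro γ h0 h1
    have ht0 : 0 ≤ 1 - γ := by linarith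
    have hsum := summable_geometric_mul_of_le_one hP0 hP1 h0 h1
    rw [← Summable.sum_add_tsum_nat_add n hsum, mul_add]
    have hh : ∑ s ∈ Finset.range n, (1 - γ) ^ s * P (s + 1) ≤ Sn := by
      rw [hSn]
      exact Finset.sum_le_sum fun s _ => mul_le_of_le_one_left (hP0 _) (pow_le_one₀ ht0 (by linarith))
    have hgeo : HasSum (fun s : ℕ => (1 - γ) ^ n * P n * (1 - γ) ^ s) ((1 - γ) ^ n * P n * γ⁻¹) := by
      have h := hasSum_geometric_of_lt_one ht0 (by linarith : 1 - γ < 1)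
      rw [show (1 : ℝ) - (1 - γ) = γ by ring] at h
      exact h.mul_left _
    have ht : ∑' s : ℕ, (1 - γ) ^ (s + n) * P (s + n + 1) ≤ (1 - γ) ^ n * P n * γ⁻¹ := by
      calc ∑' s : ℕ, (1 - γ) ^ (s + n) * P (s + n + 1)
          ≤ ∑' s : ℕ, (1 - γ) ^ n * P n * (1 - γ) ^ s := by
            refine Summable.tsum_le_tsum (fun s => ?_) ?_ hgeo.summable
            · rw [pow_add]
              have := hanti (show n ≤ s + n + 1 by omega)
              calc (1 - γ) ^ s * (1 - γ) ^ n * P (s + n + 1) ≤ (1 - γ) ^ s * (1 - γ) ^ n * P n :=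
                    mul_le_mul_of_nonneg_left this (mul_nonneg (pow_nonneg ht0 s) (pow_nonneg ht0 n))
                _ = (1 - γ) ^ n * P n * (1 - γ) ^ s := by ring
            · exact (summable_nat_add_iff n).2 hsum |>.congr (fun s => by ring_nf)
        _ = (1 - γ) ^ n * P n * γ⁻¹ := hgeo.tsum_eq
    have ht' : γ * ∑' s : ℕ, (1 - γ) ^ (s + n) * P (s + n + 1) ≤ P n := by
      calc γ * ∑' s : ℕ, (1 - γ) ^ (s + n) * P (s + n + 1) ≤ γ * ((1 - γ) ^ n * P n * γ⁻¹) :=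
            mul_le_mul_of_nonneg_left ht h0.le
        _ = (1 - γ) ^ n * P n := by field_simp
        _ ≤ 1 * P n := mul_le_mul_of_nonneg_right (pow_le_one₀ ht0 (by linarith)) (hP0 n)
        _ = P n := one_mul _
    have hh' : γ * ∑ s ∈ Finset.range n, (1 - γ) ^ s * P (s + 1) ≤ γ * Sn :=
      mul_le_mul_of_nonneg_left hh h0.le
    linarith
  -- Step 3: choose `γ = c²/(576 C² n)`
  set γ : ℝ := c ^ 2 / (576 * C ^ 2 * n) with hγ
  have hγ0 : 0 < γ := by positivity
  have hγ1 : γ < 1 := by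
    rw [hγ, div_lt_one (by positivity)]
    have : c ^ 2 ≤ (4 * C) ^ 2 := pow_le_pow_left₀ hc.le hcC 2
    nlinarith [this, hC0, show (1 : ℝ) ≤ n by exact_mod_cast hn]
  have hsγ : Real.sqrt γ = c / (24 * C * Real.sqrt n) := by
    rw [hγ, show c ^ 2 / (576 * C ^ 2 * (n : ℝ)) = (c / (24 * C)) ^ 2 / n by field_simp; ring,
      Real.sqrt_div' _ hn0.le, Real.sqrt_sq (by positivity)]
    field_simp
  have hmain := (hM γ hγ0 hγ1).trans (hsplit γ hγ0 hγ1)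
  -- `c√γ = c²/(24C√n)`, `γ S_n ≤ c²/(576C²n) · 12C√n = c²/(48 C √n)`
  have hγS : γ * Sn ≤ c ^ 2 / (48 * C * Real.sqrt n) := by
    calc γ * Sn ≤ γ * (12 * C * Real.sqrt n) := mul_le_mul_of_nonneg_left hS hγ0.le
      _ = c ^ 2 / (48 * C * Real.sqrt n) := by
          rw [hγ]
          field_simp
          rw [Real.sq_sqrt hn0.le]
          ring
  rw [hsγ] at hmain
  have e1 : c * (c / (24 * C * Real.sqrt n)) = 2 * (c ^ 2 / (48 * C) / Real.sqrt n) := by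
    field_simp; ring
  have e2 : c ^ 2 / (48 * C * Real.sqrt n) = c ^ 2 / (48 * C) / Real.sqrt n := by rw [div_div]
  linarith [hmain, hγS, e1, e2]

end TailFromGF

end Literature.Probability.Percolation

/-! ### `δ = 2` (both halves) and mean-field behaviour from the triangle condition -/

namespace Literature.Probability.FitznerVanDerHofstad2017

open MeasureTheory Literature.Probability.LatticeModels Literature.Probability.Percolation

variable {d : ℕ}

/-- **HvdH Thm. 9.2, lower half, on `ℤ^d` under the triangle condition** (`d ≥ 2`): there is `c > 0`
with `P_{p_c}(|C(0)| ≥ n) ≥ c/√n` for all `n ≥ 1`. Inputs: the Aizenman–Barsky magnetization bound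
(`magnetization_criticalProb_ge_sqrt`, every `d ≥ 2`) and the upper half
`P_{p_c}(|C(0)| ≥ n) ≤ C/√n` (`real_clusterSizeGe_criticalProb_le_of_gamma`, from `γ = 1` under the
triangle condition and Hutchcroft's Thm. 1.3), combined as in (9.2.7)–(9.2.11).
[cite: HeydenreichVanDerHofstad2017, Thm. 9.2 (9.2.1), lower bound, and its proof (9.2.7)–(9.2.11)]
[cite: FitznerVanDerHofstad2017, Cor. 1.3, EJP p. 6 (δ = 2)] -/
theorem real_clusterSizeGe_criticalProb_ge_of_triangle (hd : 2 ≤ d) (hT : TriangleCondition d) :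
    ∃ c : ℝ, 0 < c ∧ ∀ n : ℕ, 1 ≤ n →
      c / Real.sqrt n ≤ (bondPercolation (zdGraph d) (criticalProbI d)).real (clusterSizeGe (0 : Site d) n) := by
  set P : ℕ → ℝ := fun n => (bondPercolation (zdGraph d) (criticalProbI d)).real (clusterSizeGe (0 : Site d) n)
    with hP
  have hP0 : ∀ n, 0 ≤ P n := fun n => measureReal_nonneg
  have hP1 : ∀ n, P n ≤ 1 := fun n => measureReal_le_one
  have hanti : Antitone P := fun m n hmn => measureReal_mono (clusterSizeGe_antitone (0 : Site d) hmn)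
  obtain ⟨c, hc, hM⟩ := magnetization_criticalProb_ge_sqrt hd
  obtain ⟨C, hC⟩ := real_clusterSizeGe_criticalProb_le_of_gamma AizenmanNewman1984_gamma_eq_one_holds hd hT
  have hcC : c ≤ 4 * C := by
    have h1 := hM (1 / 2) (by norm_num) (by norm_num)
    have h2 := geometric_series_le_of_tail_le hP0 hP1 hanti hC (γ := 1 / 2) (by norm_num) (by norm_num)
    have hs : 0 < Real.sqrt (1 / 2 : ℝ) := Real.sqrt_pos.2 (by norm_num)
    nlinarith [h1.trans h2]
  have hC0 : 0 < C := by linarith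
  exact ⟨c ^ 2 / (48 * C), by positivity, tail_ge_of_geometric_series_ge hP0 hP1 hanti hc hM hC⟩

/-- **`δ = 2` in the bounded-ratio sense under the triangle condition** (`d ≥ 2`):
`DeltaEqTwoBoundedRatio d`. [cite: FitznerVanDerHofstad2017, Cor. 1.3 with (1.8), EJP pp. 4, 6]
[cite: HeydenreichVanDerHofstad2017, Thm. 9.2] -/
theorem deltaEqTwoBoundedRatio_of_triangle (hd : 2 ≤ d) (hT : TriangleCondition d) :
    DeltaEqTwoBoundedRatio d := by
  obtain ⟨c, hc, hlo⟩ := real_clusterSizeGe_criticalProb_ge_of_triangle hd hT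
  obtain ⟨C, hC⟩ := real_clusterSizeGe_criticalProb_le_of_gamma AizenmanNewman1984_gamma_eq_one_holds hd hT
  refine ⟨c, max C c + 1, 1, hc, by linarith [le_max_right C c], fun n hn => ⟨hlo n hn, ?_⟩⟩
  have hsn : 0 < Real.sqrt n := Real.sqrt_pos.2 (by exact_mod_cast hn)
  exact (hC n hn).trans (div_le_div_of_nonneg_right (by linarith [le_max_left C c]) hsn.le)

/-- **Mean-field behaviour from the triangle condition** (Fitzner–van der Hofstad 2017, Cor. 1.3:
"the triangle condition holds. Therefore the critical exponents `γ, β` and `δ` exist in the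
bounded-ratio sense, and take on the mean-field values `γ = β = 1, δ = 2`"; Heydenreich–van der
Hofstad 2017, Thm. 4.1), for every `d ≥ 2`: `TriangleCondition d → MeanField d`, i.e.
`θ(p_c) = 0 ∧ γ = 1 ∧ β = 1 ∧ δ = 2`. All four conjuncts are theorems of this library
(`exponents_of_triangle` and `deltaEqTwoBoundedRatio_of_triangle`).
[cite: FitznerVanDerHofstad2017, Cor. 1.3, EJP p. 6] [cite: HeydenreichVanDerHofstad2017, Thm. 4.1] -/
theorem meanField_of_triangle (hd : 2 ≤ d) (hT : TriangleCondition d) : MeanField d :=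
  ⟨percolationContinuity_of_triangle hd hT, gammaEqOneBoundedRatio_of_triangle hd hT,
    betaEqOneBoundedRatio_of_triangle hd hT, deltaEqTwoBoundedRatio_of_triangle hd hT⟩

end Literature.Probability.FitznerVanDerHofstad2017

end
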